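import Summits.ResolutionOfSingularities.ResolutionOfSingularities.Theorems.HomologicalConductorNoZenoBirthDefs
import Summits.ResolutionOfSingularities.ResolutionOfSingularities.Theorems.StrictDrop.Negative.StrictDropFalseOfSelfSimilarSeed
import Summits.ResolutionOfSingularities.ResolutionOfSingularities.Theorems.HomologicalConductorSurfaceTerminationRationalDescent
import HarnessLib

/-!
# Route `HomologicalConductor`, crux `NoZenoR` (stmt-ResolutionOfSingularities-19943): the LOOP LEMMA, hypothesis-free
# (W4.4 object (ρ17b); port of res-L0-w44-idea-1's `Sketch-idea-1-r9.lean` sha16 b93352751780d30e, §r9.1–§r9.2)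

`[OURS · L W4.4]` Cell res-hironaka, crux chain W4.4 (res-L0-w44-plan-1 RULINGS (ρ17b), 2026-08-27).  Author of record of the
mathematics and of the Lean proofs of §r9.1–§r9.2: res-L0-w44-idea-1 (technique A, card 7 `w-hilbert-no-repeat`); this file ports them
to the tree over the `BirthDefs` vocabulary (`ca`, `loc`, `chart`, `nrm`, `tower`) WITHOUT the sketch's transport hypothesis
`CaEquivariant σ` («`ca (σB) = σ (ca B)`»): that hypothesis is a THEOREM already in the tree —
`Theorems.StrictDrop.Negative.SelfSimilar.ca_map` (the cohomology annihilator is intrinsic, transported along `B ≃+* σB`;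
landed 2026-08-17 with the negative lemma `StrictDrop_false_of_SelfSimilarSeed`), which this file imports and REUSES together
with `SelfSimilar.step_map` (one tower step is `σ`-equivariant) and `SelfSimilar.tower_add_succ` (self-similarity propagates)
instead of re-proving them.  What is added here, all for a `k`-algebra automorphism `σ` of `K` with `σ(O) = O`:

* §1 EQUIVARIANCE AS EQUALITIES: `loc_map`, `isIntegral_map(_iff)`, `nrm_map`, `chart_map` (the tree had the `≤` halves
  `SelfSimilar.loc_map_le` / `nrm_map_le` / `chart_map_le`), and the whole-tower form `tower_map` —
  `σ (tower O A m) = tower O (σA) m` for EVERY seed `A` (no self-similarity assumed).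
* §2 LOOP LEMMA from stage `0`: if ONE step is realised by `σ` (`T₁ = σT₀`) then every step is
  (`tower_succ_eq_map_of_selfSimilar`, the `s = 0` reading of `SelfSimilar.tower_add_succ`), all stages are isomorphic rings, so
  regularity of a stage is independent of the stage (`isRegularLocalRing_tower_iff_of_selfSimilar`), a singular `T₀` forces
  «no stage is regular» (`no_regular_stage_of_selfSimilar` — the typed receiver of every future K4.4 LOOP certificate: one
  membership `T₁ = σT₀` plus `σ(O) = O` kill `TowerTermination` for that datum), and every `σ`-invariant function of subalgebras
  is constant along the tower (`invariant_const_of_selfSimilar` — res-L0-w44-tri-2's ι-barrier as a theorem: no `σ`-invariant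
  monovariant can strictly decrease on a loop).

* §3 LOOPS ENTERING AT A LATER STAGE `s` (appended): `isRegularLocalRing_tower_add_iff_of_selfSimilar`,
  `not_isRegularLocalRing_of_selfSimilar_of_le`, `invariant_const_add_of_selfSimilar`, and — for the route's data `k ⊆ O`,
  `Frac A = K`, `A ⊆ O` — **`no_regular_stage_of_selfSimilar_at`**: a loop certificate `T_(s+1) = σ T_s` at a SINGULAR stage
  `s` kills `∃ m, IsRegularLocalRing (T_m)` outright (stages `≥ s` are isomorphic to `T_s`; a regular stage `< s` would freeze
  the tower, `Descent.isRegularLocalRing_tower_of_le`, and make `T_s` regular).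

Nothing here is a statement of the manuscript under review (Hironaka 2017); OURS; AI-written, weaker than expert review.
-/

-- single-problem summit: the doubled namespace component `ResolutionOfSingularities` is forced
set_option linter.dupNamespace false

noncomputable section

namespace Summit.ResolutionOfSingularities.ResolutionOfSingularities.Theorems.NoZeno.Loop

open Summit.ResolutionOfSingularities.ResolutionOfSingularities.Theorems.NoZeno.Birth
open Summit.ResolutionOfSingularities.ResolutionOfSingularities.Theorems.StrictDrop.Negative
  (SelfSimilar.ca_map SelfSimilar.step_map SelfSimilar.tower_add_succ)
open Summit.ResolutionOfSingularities.ResolutionOfSingularities.Theorems.SurfaceTermination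
  (Descent.isRegularLocalRing_tower_of_le)

variable {k K : Type} [Field k] [Field K] [Algebra k K]

/-! ## §1 Equivariance of the canonical tower under `O`-preserving automorphisms (Sketch r9 §r9.1) -/

/-- Coercion unfolding for `σ : K ≃ₐ[k] K` seen as an `AlgHom`. [folklore] -/
private theorem algHom_coe_apply (σ : K ≃ₐ[k] K) (x : K) : (σ : K →ₐ[k] K) x = σ x := rfl

/-- `loc` commutes with `σ` when `σ(O) = O`. [this work] -/
theorem loc_map (O : ValuationSubring K) (σ : K ≃ₐ[k] K) (hO : ∀ x : K, σ x ∈ O ↔ x ∈ O)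
    (B : Subalgebra k K) :
    (loc O B).map (σ : K →ₐ[k] K) = loc O (B.map (σ : K →ₐ[k] K)) := by
  unfold loc
  rw [AlgHom.map_adjoin]
  congr 1
  ext y
  simp only [Set.mem_image, Set.mem_setOf_eq, Subalgebra.mem_map]
  constructor
  · rintro ⟨y', ⟨a, ha, s, hs, hsO, rfl⟩, rfl⟩
    refine ⟨σ a, ⟨a, ha, rfl⟩, σ s, ⟨s, hs, rfl⟩, ?_, ?_⟩
    · rw [← map_inv₀]; exact (hO _).mpr hsO
    · rw [algHom_coe_apply, map_mul, map_inv₀]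
  · rintro ⟨_, ⟨a, ha, rfl⟩, _, ⟨s, hs, rfl⟩, hsO, rfl⟩
    refine ⟨a * s⁻¹, ⟨a, ha, s, hs, ?_, rfl⟩, ?_⟩
    · rw [algHom_coe_apply, ← map_inv₀] at hsO; exact (hO _).mp hsO
    · rw [algHom_coe_apply, algHom_coe_apply, algHom_coe_apply, map_mul, map_inv₀]

/-- Integrality is transported by `σ`: `y` integral over `B` iff `σ y` integral over `σB` (forward half). [this work] -/
theorem isIntegral_map (σ : K ≃ₐ[k] K) (B : Subalgebra k K) {y : K} (hy : IsIntegral ↥B y) :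
    IsIntegral ↥(B.map (σ : K →ₐ[k] K)) (σ y) := by
  have h := IsIntegral.map_of_comp_eq (R := ↥B) (S := K) (T := ↥(B.map (σ : K →ₐ[k] K))) (U := K)
    ((σ.subalgebraMap B : ↥B ≃ₐ[k] ↥(B.map (σ : K →ₐ[k] K))) : ↥B →+* ↥(B.map (σ : K →ₐ[k] K)))
    (σ : K →+* K) ?_ hy
  · simpa using h
  · ext b
    rfl

/-- Integrality is transported by `σ` (iff form). [this work] -/
theorem isIntegral_map_iff (σ : K ≃ₐ[k] K) (B : Subalgebra k K) (y : K) :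
    IsIntegral ↥(B.map (σ : K →ₐ[k] K)) (σ y) ↔ IsIntegral ↥B y := by
  refine ⟨fun h => ?_, isIntegral_map σ B⟩
  have h' := isIntegral_map σ.symm (B.map (σ : K →ₐ[k] K)) h
  have hB : (B.map (σ : K →ₐ[k] K)).map (σ.symm : K →ₐ[k] K) = B := by
    rw [Subalgebra.map_map]
    have : (σ.symm : K →ₐ[k] K).comp (σ : K →ₐ[k] K) = AlgHom.id k K := by
      ext x; simp
    rw [this, Subalgebra.map_id]
  rw [hB] at h'
  simpa using h'

/-- `nrm` commutes with `σ`. [this work] -/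
theorem nrm_map (σ : K ≃ₐ[k] K) (B : Subalgebra k K) :
    (nrm B).map (σ : K →ₐ[k] K) = nrm (B.map (σ : K →ₐ[k] K)) := by
  unfold nrm
  rw [AlgHom.map_adjoin]
  congr 1
  ext y
  simp only [Set.mem_image, Set.mem_setOf_eq]
  constructor
  · rintro ⟨y', hy', rfl⟩
    rw [algHom_coe_apply]
    exact isIntegral_map σ B hy'
  · intro hy
    refine ⟨σ.symm y, ?_, by simp [algHom_coe_apply]⟩
    have := (isIntegral_map_iff σ B (σ.symm y)).mp (by simpa using hy)
    exact this

/-- `chart` commutes with `σ` when `σ(O) = O` (`ca` being `σ`-equivariant, `SelfSimilar.ca_map`). [this work] -/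
theorem chart_map (O : ValuationSubring K) (σ : K ≃ₐ[k] K) (hO : ∀ x : K, σ x ∈ O ↔ x ∈ O)
    (B : Subalgebra k K) :
    (chart O B).map (σ : K →ₐ[k] K) = chart O (B.map (σ : K →ₐ[k] K)) := by
  unfold chart
  rw [AlgHom.map_adjoin, Set.image_union]
  congr 1
  have hB : (σ : K →ₐ[k] K) '' (B : Set K) = ((B.map (σ : K →ₐ[k] K) : Subalgebra k K) : Set K) := by
    rw [Subalgebra.coe_map]
  rw [hB]
  congr 1
  rw [SelfSimilar.ca_map σ B]
  ext y
  simp only [Set.mem_image, Set.mem_setOf_eq]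
  constructor
  · rintro ⟨y', ⟨c, hc, x, hx, hx0, hmin, rfl⟩, rfl⟩
    refine ⟨σ c, ⟨c, hc, rfl⟩, σ x, ⟨x, hx, rfl⟩, ?_, ?_, ?_⟩
    · simpa using hx0
    · rintro _ ⟨c', hc', rfl⟩
      rw [← map_inv₀, ← map_mul]
      exact (hO _).mpr (hmin c' hc')
    · rw [algHom_coe_apply, map_mul, map_inv₀]
  · rintro ⟨_, ⟨c, hc, rfl⟩, _, ⟨x, hx, rfl⟩, hx0, hmin, rfl⟩
    refine ⟨c * x⁻¹, ⟨c, hc, x, hx, ?_, ?_, rfl⟩, ?_⟩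
    · intro h; apply hx0; simp [h]
    · intro c' hc'
      have := hmin (σ c') ⟨c', hc', rfl⟩
      rw [← map_inv₀, ← map_mul] at this
      exact (hO _).mp this
    · rw [algHom_coe_apply, map_mul, map_inv₀]

/-- **Equivariance of the canonical tower**: `σ (tower O A m) = tower O (σA) m` (by `loc_map` and the step
equivariance `SelfSimilar.step_map`). [this work] -/
theorem tower_map (O : ValuationSubring K) (σ : K ≃ₐ[k] K) (hO : ∀ x : K, σ x ∈ O ↔ x ∈ O)
    (A : Subalgebra k K) (m : ℕ) :
    (tower O A m).map (σ : K →ₐ[k] K) = tower O (A.map (σ : K →ₐ[k] K)) m := by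
  induction m with
  | zero => rw [tower_zero, tower_zero, loc_map O σ hO]
  | succ m ih => rw [tower_succ, tower_succ, SelfSimilar.step_map O hO, ih]

/-! ## §2 The loop lemma (Sketch r9 §r9.2) -/

/-- **Loop lemma (self-similarity propagates).** If one step of the tower is realised by an `O`-preserving automorphism
`σ` (`T₁ = σT₀`), then every step is: `T_(m+1) = σ T_m` (the stage-`0` reading of `SelfSimilar.tower_add_succ`). [this work] -/
theorem tower_succ_eq_map_of_selfSimilar (O : ValuationSubring K) (σ : K ≃ₐ[k] K)
    (hO : ∀ x : K, σ x ∈ O ↔ x ∈ O) (A : Subalgebra k K)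
    (h01 : tower O A 1 = (tower O A 0).map (σ : K →ₐ[k] K)) (m : ℕ) :
    tower O A (m + 1) = (tower O A m).map (σ : K →ₐ[k] K) := by
  have h := SelfSimilar.tower_add_succ O hO A 0 (by simpa using h01) m
  simpa only [Nat.zero_add] using h

/-- Along a self-similar tower every stage is ring-isomorphic to `T₀`; in particular regularity of a
stage is independent of the stage. [this work] -/
theorem isRegularLocalRing_tower_iff_of_selfSimilar (O : ValuationSubring K) (σ : K ≃ₐ[k] K)
    (hO : ∀ x : K, σ x ∈ O ↔ x ∈ O) (A : Subalgebra k K)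
    (h01 : tower O A 1 = (tower O A 0).map (σ : K →ₐ[k] K)) (m : ℕ) :
    IsRegularLocalRing ↥(tower O A m) ↔ IsRegularLocalRing ↥(tower O A 0) := by
  induction m with
  | zero => exact Iff.rfl
  | succ m ih =>
      rw [← ih]
      have hstep := tower_succ_eq_map_of_selfSimilar O σ hO A h01 m
      -- ring isomorphism `T_m ≃ T_(m+1)`
      let e : ↥(tower O A m) ≃ₐ[k] ↥(tower O A (m + 1)) :=
        (σ.subalgebraMap (tower O A m)).trans (Subalgebra.equivOfEq _ _ hstep.symm)
      constructor
      · intro h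
        exact IsRegularLocalRing.of_ringEquiv (R := ↥(tower O A (m + 1))) e.symm.toRingEquiv
      · intro h
        exact IsRegularLocalRing.of_ringEquiv (R := ↥(tower O A m)) e.toRingEquiv

/-- **Loop certificate ⇒ no regular stage.**  A self-similar tower starting at a singular `T₀` never reaches a
regular stage (hence the datum refutes `TowerTermination`, and with it — `PersistenceRadical` being proved —
`StrictDrop ∧ NoZenoR`, by r8 `not_strictDrop_and_noZenoR_of_not_towerTermination`). [this work] -/
theorem no_regular_stage_of_selfSimilar (O : ValuationSubring K) (σ : K ≃ₐ[k] K)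
    (hO : ∀ x : K, σ x ∈ O ↔ x ∈ O) (A : Subalgebra k K)
    (h01 : tower O A 1 = (tower O A 0).map (σ : K →ₐ[k] K))
    (hsing : ¬ IsRegularLocalRing ↥(tower O A 0)) :
    ¬ ∃ m : ℕ, IsRegularLocalRing ↥(tower O A m) := by
  rintro ⟨m, hm⟩
  exact hsing ((isRegularLocalRing_tower_iff_of_selfSimilar O σ hO A h01 m).mp hm)

/-- **Invariant monovariants are constant on loops** (tri-2's «ι-barrier», typed): any function of
subalgebras that is invariant under `σ` takes the same value on all stages of a self-similar tower, so it
cannot strictly decrease there. [this work] -/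
theorem invariant_const_of_selfSimilar {ι : Type} (Φ : Subalgebra k K → ι) (O : ValuationSubring K)
    (σ : K ≃ₐ[k] K) (hO : ∀ x : K, σ x ∈ O ↔ x ∈ O) (A : Subalgebra k K)
    (h01 : tower O A 1 = (tower O A 0).map (σ : K →ₐ[k] K))
    (hΦ : ∀ B : Subalgebra k K, Φ (B.map (σ : K →ₐ[k] K)) = Φ B) (m : ℕ) :
    Φ (tower O A m) = Φ (tower O A 0) := by
  induction m with
  | zero => rfl
  | succ m ih => rw [tower_succ_eq_map_of_selfSimilar O σ hO A h01 m, hΦ, ih]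

/-! ## §3 Loops entering at a later stage `s` (receiver for certificates `T_(s+1) = σ T_s`) -/

/-- Regularity is constant along a self-similar tower from the loop entry `s` on: `T_(s+1) = σ T_s` gives ring
isomorphisms `T_(s+n) ≃ T_(s+n+1)` (`SelfSimilar.tower_add_succ`). [this work] -/
theorem isRegularLocalRing_tower_add_iff_of_selfSimilar (O : ValuationSubring K) (σ : K ≃ₐ[k] K)
    (hO : ∀ x : K, σ x ∈ O ↔ x ∈ O) (A : Subalgebra k K) (s : ℕ)
    (hs : tower O A (s + 1) = (tower O A s).map (σ : K →ₐ[k] K)) (n : ℕ) :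
    IsRegularLocalRing ↥(tower O A (s + n)) ↔ IsRegularLocalRing ↥(tower O A s) := by
  induction n with
  | zero => exact Iff.rfl
  | succ n ih =>
      rw [← ih]
      have hstep : tower O A (s + (n + 1)) = (tower O A (s + n)).map (σ : K →ₐ[k] K) :=
        SelfSimilar.tower_add_succ O hO A s hs n
      -- ring isomorphism `T_(s+n) ≃ T_(s+n+1)`
      let e : ↥(tower O A (s + n)) ≃ₐ[k] ↥(tower O A (s + (n + 1))) :=
        (σ.subalgebraMap (tower O A (s + n))).trans (Subalgebra.equivOfEq _ _ hstep.symm)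
      constructor
      · intro h
        exact IsRegularLocalRing.of_ringEquiv (R := ↥(tower O A (s + (n + 1)))) e.symm.toRingEquiv
      · intro h
        exact IsRegularLocalRing.of_ringEquiv (R := ↥(tower O A (s + n))) e.toRingEquiv

/-- **Loop certificate at stage `s` with `T_s` singular ⇒ no regular stage at or after `s`.** [this work] -/
theorem not_isRegularLocalRing_of_selfSimilar_of_le (O : ValuationSubring K) (σ : K ≃ₐ[k] K)
    (hO : ∀ x : K, σ x ∈ O ↔ x ∈ O) (A : Subalgebra k K) (s : ℕ)
    (hs : tower O A (s + 1) = (tower O A s).map (σ : K →ₐ[k] K))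
    (hsing : ¬ IsRegularLocalRing ↥(tower O A s)) {m : ℕ} (hm : s ≤ m) :
    ¬ IsRegularLocalRing ↥(tower O A m) := by
  obtain ⟨n, rfl⟩ := Nat.exists_eq_add_of_le hm
  exact fun h => hsing ((isRegularLocalRing_tower_add_iff_of_selfSimilar O σ hO A s hs n).mp h)

/-- Every `σ`-invariant function of subalgebras is constant along the tower from the loop entry `s` on.
[this work] -/
theorem invariant_const_add_of_selfSimilar {ι : Type} (Φ : Subalgebra k K → ι) (O : ValuationSubring K)
    (σ : K ≃ₐ[k] K) (hO : ∀ x : K, σ x ∈ O ↔ x ∈ O) (A : Subalgebra k K) (s : ℕ)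
    (hs : tower O A (s + 1) = (tower O A s).map (σ : K →ₐ[k] K))
    (hΦ : ∀ B : Subalgebra k K, Φ (B.map (σ : K →ₐ[k] K)) = Φ B) (n : ℕ) :
    Φ (tower O A (s + n)) = Φ (tower O A s) := by
  induction n with
  | zero => rfl
  | succ n ih =>
      have hstep : tower O A (s + (n + 1)) = (tower O A (s + n)).map (σ : K →ₐ[k] K) :=
        SelfSimilar.tower_add_succ O hO A s hs n
      rw [hstep, hΦ, ih]

/-- **A loop certificate at ANY stage kills `∃ m, IsRegularLocalRing (T_m)`** for the route's data (`k ⊆ O`,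
`Frac A = K`, `A ⊆ O`): if `T_(s+1) = σ T_s` with `σ(O) = O` and `T_s` is singular, then NO stage is regular — stages
from `s` on are isomorphic to `T_s` (`not_isRegularLocalRing_of_selfSimilar_of_le`), and a regular stage `m < s` would
freeze the tower (`tower_succ_eq_self_of_isRegularLocalRing`, through `Descent.isRegularLocalRing_tower_of_le`) and
make `T_s` regular.  This is the receiver for K4.4 LOOP certificates found at a late stage. [this work] -/
theorem no_regular_stage_of_selfSimilar_at (O : ValuationSubring K) (σ : K ≃ₐ[k] K)
    (hO : ∀ x : K, σ x ∈ O ↔ x ∈ O) (A : Subalgebra k K) (hk : ∀ c : k, algebraMap k K c ∈ O)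
    (hfr : IsFractionRing ↥A K) (hAO : A.toSubring ≤ O.toSubring) (s : ℕ)
    (hs : tower O A (s + 1) = (tower O A s).map (σ : K →ₐ[k] K))
    (hsing : ¬ IsRegularLocalRing ↥(tower O A s)) :
    ¬ ∃ m : ℕ, IsRegularLocalRing ↥(tower O A m) := by
  rintro ⟨m, hm⟩
  rcases le_total s m with hsm | hms
  · exact not_isRegularLocalRing_of_selfSimilar_of_le O σ hO A s hs hsing hsm hm
  · exact hsing (Descent.isRegularLocalRing_tower_of_le O A hk hfr hAO hms hm)

end Summit.ResolutionOfSingularities.ResolutionOfSingularities.Theorems.NoZeno.Loop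

end
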